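import Literature.NumberTheory.LFunctions.KloostermanFractionsFromCbTools
import Literature.NumberTheory.LFunctions.KloostermanFractionsFromC1
import Literature.NumberTheory.LFunctions.KloostermanFractionsWeilBound
import HarnessLib

/-!
# Bilinear forms with Kloosterman fractions: from Bettin–Chandee (5.2) to (6.4) and the named fact

Topic `NumberTheory/LFunctions`.  S. Bettin, V. Chandee, *Trilinear forms with Kloosterman
fractions*, Adv. Math. 328 (2018), §6, second half: "We choose `B = N^{1/2}`, so that combining
(6.2) and (6.1) we obtain … Notice that the third summand can be absorbed.  Indeed, if `M ≪ N²`,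
then `AM^{6/5}N^{1/10} ≪ AMN^{3/4}`, whereas if `M ≫ N²` then one can obtain a stronger bound from
Theorem 5 of [DFI97] … Moreover `AM^{1/2}N^{5/4} ≪ AMN^{3/4} + AN^{7/4}` and thus (6.4)."  This file
PROVES that derivation (single numerator, `A = 1`, `ϑ = k`, second moments with `m ∼ M`) from the
tools of `KloostermanFractionsFromCbTools.lean`, `KloostermanFractionsSquarefull.lean` (`Z ≪ N^ε`)
and `KloostermanFractionsWeilBound.lean` (Theorem 5 of Duke–Friedlander–Iwaniec), and chains it
with `KloostermanFractionsFromC1.lean`: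

* **`BC_C1_bound_of_Cb_bound`** — hypothesis: (5.2) for every squarefull `b ≥ 1` coprime to `k`,
  `M, N' ≥ 1/2`, `b ≤ N'`, `γ` on squarefree `N' < n ≤ 2N'` coprime to `bk`:
  `∑_{M<m≤2M,(m,b)=1} |kfInner k b N' γ m|² ≤ K ‖γ‖² (bMN'(1+|k|))^ε (1+|k|/(bN'M))^{1/2}(M(bN')^{1/2} + b^{3/4}M^{1/2}N'^{5/4} + M^{6/5}N'^{1/10}b^{-2/5} + b^{1/5}M^{6/5}N'^{7/10} + b^{1/2}M^{3/5}N'^{13/10} + b^{1/2}N'^{7/4})`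
  (the source's `M^ε` under "`b, ϑ, N ≪ M^C`" rendered as `(bMN'(1+|k|))^ε`); conclusion: the
  (6.4)-shape hypothesis of `DukeFriedlanderIwaniec1997_bilinearKloostermanFractions_of_C1_bound`;
* **`DukeFriedlanderIwaniec1997_bilinearKloostermanFractions_of_Cb_bound`** — hence the named fact
  from (5.2).  What remains of Bettin–Chandee's paper for the named fact is exactly §§3–5: the bound
  (5.2) for the amplified second moment with a FIXED squarefull `b`.

## References

* S. Bettin, V. Chandee, Adv. Math. 328 (2018) 1234–1262 (arXiv:1502.00769), (5.2), §6 ((6.3), (6.4)).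
  [BettinChandee2018]
* W. Duke, J. Friedlander, H. Iwaniec, Invent. Math. 128 (1997) 23–43, Theorems 2 and 5.
  [DukeFriedlanderIwaniec1997]
-/

noncomputable section

open Finset Real Complex

namespace Literature.NumberTheory.LFunctions

set_option maxHeartbeats 400000 in
/-- **Bettin–Chandee §6, second half: from the bound (5.2) for `𝓒_b` to (6.4) for `𝓒₁`.**
Hypothesis ((5.2), case `A = 1`, `ϑ = k`, in the tree's notation `kfInner`, second moments with
`m ∼ M`, and the standing assumptions of §§3–5 of the source: `b ≥ 1` squarefull and coprime to `k`,
`b ≤ N'` (only these `b` are needed: `b ≤ N^{1/2}` in §6), `γ` supported on squarefree `N' < n ≤ 2N'`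
coprime to `b` and to `k`; the source's `M^ε` under "`b, ϑ, N ≪ M^C`" is rendered as
`(b M N' (1+|k|))^ε`): for every `ε > 0` there is `K` with
`∑_{M<m≤2M,(m,b)=1} |kfInner k b N' γ m|² ≤ K ‖γ‖² (bMN'(1+|k|))^ε (1 + |k|/(bN'M))^{1/2} (M(bN')^{1/2} + b^{3/4}M^{1/2}N'^{5/4} + M^{6/5}N'^{1/10}b^{-2/5} + b^{1/5}M^{6/5}N'^{7/10} + b^{1/2}M^{3/5}N'^{13/10} + b^{1/2}N'^{7/4})`.
Conclusion ((6.4), the hypothesis of `DukeFriedlanderIwaniec1997_bilinearKloostermanFractions_of_C1_bound`):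
for `M, N ≥ 1/2`, `k ≠ 0`, `β` on `N < n ≤ 2N` coprime to `k`,
`𝓒₁ ≤ K' (1+|k|)^ε ‖β‖² (MN)^ε (1 + |k|/MN)^{1/2}(MN^{3/4} + N^{7/4} + M^{6/5}N^{7/10} + M^{3/5}N^{13/10})`.
Proof as in the source: `𝓒₁ ≤ Z ∑_b b^{1/2} 𝓒_b(M, N/b; β_b)` (`BC_C1I_le_sum_sqfull`), (5.2)
for `b ≤ N^{1/2}` (`BC_terms52_le`) and the trivial bound for `b > N^{1/2}` (`BC_sqrtb_Cb_le`),
`∑_b ‖β_b‖² = ‖β‖²`, `Z ≪ N^ε` (`sum_sqfull_inv_sqrt_le`), the absorptions `BC_terms6_absorb` for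
`M ≤ 4N²`, and Theorem 5 of Duke–Friedlander–Iwaniec (`DFI_C_weil_bound`) for `M > 4N²`.
[cite: BettinChandee2018, §6] -/
theorem BC_C1_bound_of_Cb_bound
    (h52 : ∀ ε : ℝ, 0 < ε → ∃ K : ℝ, 0 < K ∧ ∀ (b : ℕ), 0 < b → (∀ p ∈ b.primeFactors, p ^ 2 ∣ b) →
      ∀ (M N' : ℝ), 1 / 2 ≤ M → 1 / 2 ≤ N' → (b : ℝ) ≤ N' → ∀ (k : ℤ), k ≠ 0 → b.Coprime k.natAbs →
      ∀ (γ : ℕ → ℂ),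
        (∀ n : ℕ, γ n ≠ 0 → N' < n ∧ (n : ℝ) ≤ 2 * N') →
        (∀ n : ℕ, γ n ≠ 0 → Squarefree n ∧ n.Coprime b ∧ n.Coprime k.natAbs) →
        ∑ m ∈ (Ioc ⌊M⌋₊ ⌊2 * M⌋₊).filter (fun m => m.Coprime b), ‖kfInner k b N' γ m‖ ^ 2 ≤
          K * (∑ n ∈ Icc 1 ⌊2 * N'⌋₊, ‖γ n‖ ^ 2) *
          ((b : ℝ) * M * N' * (1 + |(k : ℝ)|)) ^ ε * (1 + |(k : ℝ)| / ((b : ℝ) * N' * M)) ^ (1 / 2 : ℝ) *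
          (M * ((b : ℝ) * N') ^ (1 / 2 : ℝ) + (b : ℝ) ^ (3 / 4 : ℝ) * M ^ (1 / 2 : ℝ) * N' ^ (5 / 4 : ℝ) +
            M ^ (6 / 5 : ℝ) * N' ^ (1 / 10 : ℝ) * (b : ℝ) ^ (-(2 / 5) : ℝ) +
            (b : ℝ) ^ (1 / 5 : ℝ) * M ^ (6 / 5 : ℝ) * N' ^ (7 / 10 : ℝ) +
            (b : ℝ) ^ (1 / 2 : ℝ) * M ^ (3 / 5 : ℝ) * N' ^ (13 / 10 : ℝ) + (b : ℝ) ^ (1 / 2 : ℝ) * N' ^ (7 / 4 : ℝ))) :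
    ∀ ε : ℝ, 0 < ε → ∃ K : ℝ, 0 < K ∧
      ∀ (M N : ℝ), 1 / 2 ≤ M → 1 / 2 ≤ N → ∀ (k : ℤ), k ≠ 0 → ∀ (β : ℕ → ℂ),
        (∀ n : ℕ, β n ≠ 0 → N < n ∧ (n : ℝ) ≤ 2 * N) →
        (∀ n : ℕ, β n ≠ 0 → n.Coprime k.natAbs) →
        ∑ m ∈ Ioc ⌊M⌋₊ ⌊2 * M⌋₊, ‖∑ n ∈ Icc 1 ⌊2 * N⌋₊,
            (if m.Coprime n then
              β n * Complex.exp (2 * Real.pi * Complex.I *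
                ((k : ℂ) * ((((m : ZMod n)⁻¹).val : ℕ) : ℂ) / (n : ℂ)))
            else 0)‖ ^ 2 ≤
          K * (1 + |(k : ℝ)|) ^ ε * (∑ n ∈ Icc 1 ⌊2 * N⌋₊, ‖β n‖ ^ 2) * (M * N) ^ ε *
            (1 + |(k : ℝ)| / (M * N)) ^ (1 / 2 : ℝ) *
            (M * N ^ (3 / 4 : ℝ) + N ^ (7 / 4 : ℝ) + M ^ (6 / 5 : ℝ) * N ^ (7 / 10 : ℝ) +
              M ^ (3 / 5 : ℝ) * N ^ (13 / 10 : ℝ)) := by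
  intro ε hε
  obtain ⟨K₅, hK₅, h5⟩ := h52 (ε / 2) (by positivity)
  obtain ⟨CZ, hCZ, hZ⟩ := sum_sqfull_inv_sqrt_le (ε := ε / 2) (by positivity)
  obtain ⟨CW, hCW, hW⟩ := DFI_C_weil_bound (ε := ε) hε
  obtain ⟨A, hA⟩ : ∃ A : ℝ, A = (2 : ℝ) ^ ε := ⟨_, rfl⟩
  have hA0 : 0 < A := by rw [hA]; positivity
  have hA1 : 1 ≤ A := by rw [hA]; exact Real.one_le_rpow (by norm_num) hε.le
  refine ⟨8 * A * CW + CZ * A * (5 * K₅ + 4 * A), by positivity, ?_⟩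
  intro M N hM hN k hk β hβ hβk
  have hM0 : 0 < M := by linarith
  have hN0 : 0 < N := by linarith
  have hQ0 : 0 < M * N := mul_pos hM0 hN0
  have hQ4 : 1 / 4 ≤ M * N := by nlinarith
  have hkk0 : 0 < 1 + |(k : ℝ)| := by positivity
  have hkk1 : 1 ≤ 1 + |(k : ℝ)| := by have := abs_nonneg (k : ℝ); linarith
  have hW0 : 0 < 1 + |(k : ℝ)| / (M * N) := by positivity
  have hW1 : 1 ≤ 1 + |(k : ℝ)| / (M * N) := by
    have : 0 ≤ |(k : ℝ)| / (M * N) := by positivity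
    linarith
  -- abbreviations (opaque)
  obtain ⟨X, hX⟩ : ∃ X : ℕ, X = ⌊2 * N⌋₊ := ⟨_, rfl⟩
  have hXpos : 0 < X := by rw [hX]; exact Nat.floor_pos.mpr (by linarith)
  have hXle : (X : ℝ) ≤ 2 * N := by rw [hX]; exact Nat.floor_le (by positivity)
  obtain ⟨nβ2, hnβ2⟩ : ∃ x : ℝ, x = ∑ n ∈ Icc 1 ⌊2 * N⌋₊, ‖β n‖ ^ 2 := ⟨_, rfl⟩
  have hnβ0 : 0 ≤ nβ2 := by rw [hnβ2]; exact Finset.sum_nonneg fun _ _ => sq_nonneg _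
  obtain ⟨S₄, hS₄⟩ : ∃ x : ℝ, x = M * N ^ (3 / 4 : ℝ) + N ^ (7 / 4 : ℝ) + M ^ (6 / 5 : ℝ) * N ^ (7 / 10 : ℝ) +
      M ^ (3 / 5 : ℝ) * N ^ (13 / 10 : ℝ) := ⟨_, rfl⟩
  have hMN34S : M * N ^ (3 / 4 : ℝ) ≤ S₄ := by
    have p2 : 0 ≤ N ^ (7 / 4 : ℝ) := by positivity
    have p3 : 0 ≤ M ^ (6 / 5 : ℝ) * N ^ (7 / 10 : ℝ) := by positivity
    have p4 : 0 ≤ M ^ (3 / 5 : ℝ) * N ^ (13 / 10 : ℝ) := by positivity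
    rw [hS₄]; linarith
  have hMN340 : 0 ≤ M * N ^ (3 / 4 : ℝ) := by positivity
  have hS₄0 : 0 ≤ S₄ := hMN340.trans hMN34S
  have hMS : M ≤ 2 * S₄ := by
    -- `N^{3/4} ≥ (1/2)^{3/4} ≥ 1/2`
    have h1 : (1 / 2 : ℝ) ≤ N ^ (3 / 4 : ℝ) := by
      have h2 : (1 / 2 : ℝ) ^ (3 / 4 : ℝ) ≤ N ^ (3 / 4 : ℝ) := Real.rpow_le_rpow (by norm_num) hN (by norm_num)
      have h3 : (1 / 2 : ℝ) ≤ (1 / 2 : ℝ) ^ (3 / 4 : ℝ) := by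
        calc (1 / 2 : ℝ) = (1 / 2 : ℝ) ^ (1 : ℝ) := (Real.rpow_one _).symm
          _ ≤ (1 / 2 : ℝ) ^ (3 / 4 : ℝ) :=
            Real.rpow_le_rpow_of_exponent_ge (by norm_num) (by norm_num) (by norm_num)
      linarith
    nlinarith
  -- `N^ε ≤ A (MN)^ε` (as `M ≥ 1/2`)
  have hNε : ∀ e : ℝ, 0 ≤ e → N ^ e ≤ (2 : ℝ) ^ e * (M * N) ^ e := by
    intro e he
    have h1 : N = 2 * (M * N * (1 / (2 * M))) := by field_simp
    have h2 : M * N * (1 / (2 * M)) ≤ M * N := by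
      have : 1 / (2 * M) ≤ 1 := by rw [div_le_one (by positivity)]; linarith
      exact mul_le_of_le_one_right hQ0.le this
    calc N ^ e = (2 * (M * N * (1 / (2 * M)))) ^ e := by rw [← h1]
      _ = (2 : ℝ) ^ e * (M * N * (1 / (2 * M))) ^ e := Real.mul_rpow (by norm_num) (by positivity)
      _ ≤ (2 : ℝ) ^ e * (M * N) ^ e := by gcongr
  -- the target quantity
  obtain ⟨T, hT⟩ : ∃ x : ℝ, x = (1 + |(k : ℝ)|) ^ ε * nβ2 * (M * N) ^ ε *
      (1 + |(k : ℝ)| / (M * N)) ^ (1 / 2 : ℝ) * S₄ := ⟨_, rfl⟩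
  have hT0 : 0 ≤ T := by rw [hT]; positivity
  have hTlow : nβ2 * (M * N) ^ ε * S₄ ≤ T := by
    have h1 : 1 ≤ (1 + |(k : ℝ)|) ^ ε := Real.one_le_rpow hkk1 hε.le
    have h2 : 1 ≤ (1 + |(k : ℝ)| / (M * N)) ^ (1 / 2 : ℝ) := Real.one_le_rpow hW1 (by norm_num)
    have h3 : 0 ≤ nβ2 * (M * N) ^ ε * S₄ := by positivity
    rw [hT]
    calc nβ2 * (M * N) ^ ε * S₄ = 1 * nβ2 * (M * N) ^ ε * 1 * S₄ := by ring
      _ ≤ (1 + |(k : ℝ)|) ^ ε * nβ2 * (M * N) ^ ε * (1 + |(k : ℝ)| / (M * N)) ^ (1 / 2 : ℝ) * S₄ := by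
          gcongr
  suffices hmain : ∑ m ∈ Ioc ⌊M⌋₊ ⌊2 * M⌋₊, ‖∑ n ∈ Icc 1 ⌊2 * N⌋₊,
      (if m.Coprime n then
        β n * Complex.exp (2 * Real.pi * Complex.I *
          ((k : ℂ) * ((((m : ZMod n)⁻¹).val : ℕ) : ℂ) / (n : ℂ)))
      else 0)‖ ^ 2 ≤ (8 * A * CW + CZ * A * (5 * K₅ + 4 * A)) * T by
    rw [hT, hnβ2, hS₄] at hmain
    calc _ ≤ _ := hmain
      _ = _ := by ring
  -- the `m`-range `(⌊M⌋, ⌊2M⌋]` is contained in `[1, ⌊2M⌋]`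
  have hsub : Ioc ⌊M⌋₊ ⌊2 * M⌋₊ ⊆ Icc 1 ⌊2 * M⌋₊ := by
    intro m hm
    rw [Finset.mem_Ioc] at hm
    rw [Finset.mem_Icc]
    exact ⟨by omega, hm.2⟩
  by_cases hcase : 4 * N ^ 2 < M
  · -- Case `M > 4N²`: Theorem 5 of Duke–Friedlander–Iwaniec
    have hN2M : N ^ 2 ≤ M := by nlinarith
    have hweil := hW M N hM0.le hN k β hβ hβk
    rw [← hnβ2] at hweil
    calc _ ≤ ∑ m ∈ Icc 1 ⌊2 * M⌋₊, ‖∑ n ∈ Icc 1 ⌊2 * N⌋₊,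
          (if m.Coprime n then
            β n * Complex.exp (2 * Real.pi * Complex.I *
              ((k : ℂ) * ((((m : ZMod n)⁻¹).val : ℕ) : ℂ) / (n : ℂ)))
          else 0)‖ ^ 2 := Finset.sum_le_sum_of_subset_of_nonneg hsub fun _ _ _ => sq_nonneg _
      _ ≤ CW * (M + N ^ 2) * N ^ ε * nβ2 := hweil
      _ ≤ CW * (2 * M) * ((2 : ℝ) ^ ε * (M * N) ^ ε) * nβ2 := by
          have h1 : M + N ^ 2 ≤ 2 * M := by linarith
          have h2 := hNε ε hε.le
          gcongr
      _ ≤ CW * (2 * (2 * S₄)) * (A * (M * N) ^ ε) * nβ2 := by rw [hA]; gcongr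
      _ = 4 * A * CW * (nβ2 * (M * N) ^ ε * S₄) := by ring
      _ ≤ 4 * A * CW * T := by gcongr
      _ ≤ (8 * A * CW + CZ * A * (5 * K₅ + 4 * A)) * T := by
          have e1 : 0 ≤ CZ * A * (5 * K₅ + 4 * A) * T := by positivity
          have e2 : 0 ≤ A * CW * T := by positivity
          have e : (8 * A * CW + CZ * A * (5 * K₅ + 4 * A)) * T =
              8 * (A * CW * T) + CZ * A * (5 * K₅ + 4 * A) * T := by ring
          rw [e]; linarith
  · -- Case `M ≤ 4N²`: Bettin–Chandee §6
    have hM4N : M ≤ 4 * N ^ 2 := not_lt.mp hcase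
    -- the bound `Φ = E T₆ + 4MN^{3/4}` of `BC_sqrtb_Cb_le`, and `Φ ≤ (5K₅ + 4A) (…)`
    obtain ⟨T6, hT6⟩ : ∃ T6 : ℝ, T6 = M * N ^ (3 / 4 : ℝ) + M ^ (1 / 2 : ℝ) * N ^ (5 / 4 : ℝ) +
        M ^ (6 / 5 : ℝ) * N ^ (1 / 10 : ℝ) + M ^ (6 / 5 : ℝ) * N ^ (7 / 10 : ℝ) +
        M ^ (3 / 5 : ℝ) * N ^ (13 / 10 : ℝ) + N ^ (7 / 4 : ℝ) := ⟨_, rfl⟩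
    have h6' : T6 ≤ 5 * S₄ := by rw [hT6, hS₄]; exact BC_terms6_absorb hM0 hN hM4N
    obtain ⟨E, hE⟩ : ∃ E : ℝ, E = K₅ * (M * N * (1 + |(k : ℝ)|)) ^ (ε / 2) *
        (1 + |(k : ℝ)| / (M * N)) ^ (1 / 2 : ℝ) := ⟨_, rfl⟩
    have hE0 : 0 ≤ E := by rw [hE]; positivity
    obtain ⟨Φ, hΦ⟩ : ∃ Φ : ℝ, Φ = E * T6 + 4 * (M * N ^ (3 / 4 : ℝ)) := ⟨_, rfl⟩
    -- per-`b` bound (`BC_sqrtb_Cb_le`)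
    have hper : ∀ b ∈ (Icc 1 X).filter (fun b => ∀ p ∈ b.primeFactors, p ^ 2 ∣ b),
        Real.sqrt b * ∑ m ∈ (Ioc ⌊M⌋₊ ⌊2 * M⌋₊).filter (fun m => m.Coprime b),
          ‖kfInner k b (N / b) (fun n' => if Squarefree n' ∧ n'.Coprime b then β (b * n') else 0) m‖ ^ 2 ≤
        (∑ n' ∈ Icc 1 ⌊2 * (N / b)⌋₊,
          ‖(fun n' => if Squarefree n' ∧ n'.Coprime b then β (b * n') else 0) n'‖ ^ 2) * Φ := by
      intro b hb
      rw [Finset.mem_filter, Finset.mem_Icc] at hb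
      have h := BC_sqrtb_Cb_le (ε := ε / 2) hK₅ hM hN hk hβ hβk h5 hb.1.1 hb.2
        (fun n' => if Squarefree n' ∧ n'.Coprime b then β (b * n') else 0)
        (by
          intro n' hn'
          have hn'' : (if Squarefree n' ∧ n'.Coprime b then β (b * n') else 0) ≠ 0 := hn'
          by_cases hc : Squarefree n' ∧ n'.Coprime b
          · rw [if_pos hc] at hn''
            exact ⟨hc.1, hc.2, hn''⟩
          · rw [if_neg hc] at hn''
            exact absurd rfl hn'')
      rw [hΦ, hE, hT6]; exact h
    -- summing over `b`: `∑_b ‖β_b‖² = ‖β‖²`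
    have hfl : ∀ b : ℕ, ⌊2 * (N / b)⌋₊ = X / b := fun b => by
      rw [hX, show (2 : ℝ) * (N / b) = 2 * N / b by ring, Nat.floor_div_natCast]
    have hsumβ : ∑ b ∈ (Icc 1 X).filter (fun b => ∀ p ∈ b.primeFactors, p ^ 2 ∣ b),
        (∑ n' ∈ Icc 1 ⌊2 * (N / b)⌋₊,
          ‖(fun n' => if Squarefree n' ∧ n'.Coprime b then β (b * n') else 0) n'‖ ^ 2) = nβ2 := by
      rw [hnβ2, ← hX, ← sum_sqfull_normSq_betab_eq X β]
      refine Finset.sum_congr rfl fun b _ => ?_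
      rw [hfl b]
    have hsum : ∑ b ∈ (Icc 1 X).filter (fun b => ∀ p ∈ b.primeFactors, p ^ 2 ∣ b),
        Real.sqrt b * ∑ m ∈ (Ioc ⌊M⌋₊ ⌊2 * M⌋₊).filter (fun m => m.Coprime b),
          ‖kfInner k b (N / b) (fun n' => if Squarefree n' ∧ n'.Coprime b then β (b * n') else 0) m‖ ^ 2 ≤
        nβ2 * Φ := by
      refine (Finset.sum_le_sum hper).trans (le_of_eq ?_)
      rw [← Finset.sum_mul, hsumβ]
    -- `Z ≤ CZ X^{ε/2} ≤ CZ 2^{ε/2} 2^{ε/2} (MN)^{ε/2}`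
    have hZle : ∑ b ∈ (Icc 1 X).filter (fun b => ∀ p ∈ b.primeFactors, p ^ 2 ∣ b), (Real.sqrt b)⁻¹ ≤
        CZ * (A * (M * N) ^ (ε / 2)) := by
      have h1 := hZ X hXpos
      have h2 : (X : ℝ) ^ (ε / 2) ≤ A * (M * N) ^ (ε / 2) := by
        calc (X : ℝ) ^ (ε / 2) ≤ (2 * N) ^ (ε / 2) := Real.rpow_le_rpow (by positivity) hXle (by positivity)
          _ = (2 : ℝ) ^ (ε / 2) * N ^ (ε / 2) := Real.mul_rpow (by norm_num) hN0.le
          _ ≤ (2 : ℝ) ^ (ε / 2) * ((2 : ℝ) ^ (ε / 2) * (M * N) ^ (ε / 2)) := by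
              gcongr; exact hNε (ε / 2) (by positivity)
          _ = A * (M * N) ^ (ε / 2) := by
              rw [hA, ← mul_assoc, ← Real.rpow_add (by norm_num)]; ring_nf
      exact h1.trans (by gcongr)
    -- `Φ ≤ (5 K₅ + 4 A) (1+|k|)^ε (MN)^{ε/2} (1+|k|/MN)^{1/2} S₄`
    have hΦle : Φ ≤ (5 * K₅ + 4 * A) * ((1 + |(k : ℝ)|) ^ ε * (M * N) ^ (ε / 2) *
        (1 + |(k : ℝ)| / (M * N)) ^ (1 / 2 : ℝ) * S₄) := by
      have hkkε : (M * N * (1 + |(k : ℝ)|)) ^ (ε / 2) ≤ (1 + |(k : ℝ)|) ^ ε * (M * N) ^ (ε / 2) := by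
        rw [Real.mul_rpow hQ0.le hkk0.le]
        have h1 : (1 + |(k : ℝ)|) ^ (ε / 2) ≤ (1 + |(k : ℝ)|) ^ ε :=
          Real.rpow_le_rpow_of_exponent_le hkk1 (by linarith)
        have h2 : 0 ≤ (M * N) ^ (ε / 2) := by positivity
        calc (M * N) ^ (ε / 2) * (1 + |(k : ℝ)|) ^ (ε / 2) ≤ (M * N) ^ (ε / 2) * (1 + |(k : ℝ)|) ^ ε :=
              mul_le_mul_of_nonneg_left h1 h2
          _ = _ := mul_comm _ _
      have hQA : 1 ≤ A * (M * N) ^ (ε / 2) := by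
        have h1 : (1 / 4 : ℝ) ^ (ε / 2) ≤ (M * N) ^ (ε / 2) := Real.rpow_le_rpow (by norm_num) hQ4 (by positivity)
        have h2 : A * (1 / 4 : ℝ) ^ (ε / 2) = 1 := by
          have e1 : (1 / 4 : ℝ) ^ (ε / 2) = (1 / 2 : ℝ) ^ ε := by
            rw [show (1 / 4 : ℝ) = (1 / 2 : ℝ) ^ (2 : ℝ) by norm_num, ← Real.rpow_mul (by norm_num)]
            ring_nf
          rw [e1, Real.div_rpow zero_le_one (by norm_num), Real.one_rpow, hA]
          field_simp
        calc (1 : ℝ) = A * (1 / 4 : ℝ) ^ (ε / 2) := h2.symm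
          _ ≤ A * (M * N) ^ (ε / 2) := by gcongr
      have hW12 : 1 ≤ (1 + |(k : ℝ)| / (M * N)) ^ (1 / 2 : ℝ) := Real.one_le_rpow hW1 (by norm_num)
      have hkk1' : 1 ≤ (1 + |(k : ℝ)|) ^ ε := Real.one_le_rpow hkk1 hε.le
      have b1 : E * T6 ≤ K₅ * ((1 + |(k : ℝ)|) ^ ε * (M * N) ^ (ε / 2)) *
          (1 + |(k : ℝ)| / (M * N)) ^ (1 / 2 : ℝ) * (5 * S₄) := by
        rw [hE]
        have hT60 : 0 ≤ T6 := by
          have p1 : 0 ≤ M * N ^ (3 / 4 : ℝ) := by positivity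
          have p2 : 0 ≤ M ^ (1 / 2 : ℝ) * N ^ (5 / 4 : ℝ) := by positivity
          have p3 : 0 ≤ M ^ (6 / 5 : ℝ) * N ^ (1 / 10 : ℝ) := by positivity
          have p4 : 0 ≤ M ^ (6 / 5 : ℝ) * N ^ (7 / 10 : ℝ) := by positivity
          have p5 : 0 ≤ M ^ (3 / 5 : ℝ) * N ^ (13 / 10 : ℝ) := by positivity
          have p6 : 0 ≤ N ^ (7 / 4 : ℝ) := by positivity
          rw [hT6]; linarith
        gcongr
      have b2 : 4 * (M * N ^ (3 / 4 : ℝ)) ≤ 4 * S₄ * (A * (M * N) ^ (ε / 2)) * (1 + |(k : ℝ)|) ^ ε *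
          (1 + |(k : ℝ)| / (M * N)) ^ (1 / 2 : ℝ) := by
        have p0 : 0 ≤ 4 * S₄ := by linarith
        have e1 : 4 * (M * N ^ (3 / 4 : ℝ)) ≤ 4 * S₄ := by linarith
        have e2 : 4 * S₄ ≤ 4 * S₄ * (A * (M * N) ^ (ε / 2)) := le_mul_of_one_le_right p0 hQA
        have p1 : 0 ≤ 4 * S₄ * (A * (M * N) ^ (ε / 2)) := mul_nonneg p0 (by positivity)
        have e3 : 4 * S₄ * (A * (M * N) ^ (ε / 2)) ≤ 4 * S₄ * (A * (M * N) ^ (ε / 2)) * (1 + |(k : ℝ)|) ^ ε :=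
          le_mul_of_one_le_right p1 hkk1'
        have p2 : 0 ≤ 4 * S₄ * (A * (M * N) ^ (ε / 2)) * (1 + |(k : ℝ)|) ^ ε := mul_nonneg p1 (by positivity)
        have e4 : 4 * S₄ * (A * (M * N) ^ (ε / 2)) * (1 + |(k : ℝ)|) ^ ε ≤
            4 * S₄ * (A * (M * N) ^ (ε / 2)) * (1 + |(k : ℝ)|) ^ ε * (1 + |(k : ℝ)| / (M * N)) ^ (1 / 2 : ℝ) :=
          le_mul_of_one_le_right p2 hW12
        linarith
      calc Φ = E * T6 + 4 * (M * N ^ (3 / 4 : ℝ)) := hΦ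
        _ ≤ K₅ * ((1 + |(k : ℝ)|) ^ ε * (M * N) ^ (ε / 2)) * (1 + |(k : ℝ)| / (M * N)) ^ (1 / 2 : ℝ) * (5 * S₄) +
            4 * S₄ * (A * (M * N) ^ (ε / 2)) * (1 + |(k : ℝ)|) ^ ε *
              (1 + |(k : ℝ)| / (M * N)) ^ (1 / 2 : ℝ) := add_le_add b1 b2
        _ = (5 * K₅ + 4 * A) * ((1 + |(k : ℝ)|) ^ ε * (M * N) ^ (ε / 2) *
            (1 + |(k : ℝ)| / (M * N)) ^ (1 / 2 : ℝ) * S₄) := by ring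
    have hΦ0 : 0 ≤ Φ := by
      have hT60 : M * N ^ (3 / 4 : ℝ) ≤ T6 := by
        have p2 : 0 ≤ M ^ (1 / 2 : ℝ) * N ^ (5 / 4 : ℝ) := by positivity
        have p3 : 0 ≤ M ^ (6 / 5 : ℝ) * N ^ (1 / 10 : ℝ) := by positivity
        have p4 : 0 ≤ M ^ (6 / 5 : ℝ) * N ^ (7 / 10 : ℝ) := by positivity
        have p5 : 0 ≤ M ^ (3 / 5 : ℝ) * N ^ (13 / 10 : ℝ) := by positivity
        have p6 : 0 ≤ N ^ (7 / 4 : ℝ) := by positivity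
        rw [hT6]; linarith
      rw [hΦ]; exact add_nonneg (mul_nonneg hE0 (hMN340.trans hT60)) (by positivity)
    -- assemble
    have hZ0 : 0 ≤ ∑ b ∈ (Icc 1 X).filter (fun b => ∀ p ∈ b.primeFactors, p ^ 2 ∣ b), (Real.sqrt b)⁻¹ :=
      Finset.sum_nonneg fun b _ => inv_nonneg.mpr (Real.sqrt_nonneg _)
    have hsq := BC_C1I_le_sum_sqfull k M N β
    rw [hX] at hZle hsum hZ0
    calc _ ≤ _ := hsq
      _ ≤ (CZ * (A * (M * N) ^ (ε / 2))) * (nβ2 * Φ) := by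
          refine mul_le_mul hZle hsum ?_ (by positivity)
          exact Finset.sum_nonneg fun b _ => mul_nonneg (Real.sqrt_nonneg _)
            (Finset.sum_nonneg fun _ _ => sq_nonneg _)
      _ ≤ (CZ * (A * (M * N) ^ (ε / 2))) * (nβ2 * ((5 * K₅ + 4 * A) * ((1 + |(k : ℝ)|) ^ ε * (M * N) ^ (ε / 2) *
            (1 + |(k : ℝ)| / (M * N)) ^ (1 / 2 : ℝ) * S₄))) := by gcongr
      _ = CZ * A * (5 * K₅ + 4 * A) * ((1 + |(k : ℝ)|) ^ ε * nβ2 * ((M * N) ^ (ε / 2) * (M * N) ^ (ε / 2)) *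
            (1 + |(k : ℝ)| / (M * N)) ^ (1 / 2 : ℝ) * S₄) := by ring
      _ = CZ * A * (5 * K₅ + 4 * A) * T := by
          rw [hT, ← Real.rpow_add hQ0]; ring_nf
      _ ≤ (8 * A * CW + CZ * A * (5 * K₅ + 4 * A)) * T := by
          have e1 : 0 ≤ A * CW * T := by positivity
          have e : (8 * A * CW + CZ * A * (5 * K₅ + 4 * A)) * T =
              8 * (A * CW * T) + CZ * A * (5 * K₅ + 4 * A) * T := by ring
          rw [e]; linarith

/-- **The named fact from Bettin–Chandee (5.2)** (case `A = 1`, untwisted, `m ∼ M`, in terms of the tree's `kfInner`, the standing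
assumptions of §§3–5): the hypothesis of `BC_C1_bound_of_Cb_bound` implies
`DukeFriedlanderIwaniec1997_bilinearKloostermanFractions`.  Everything of Bettin–Chandee's paper
outside §§3–5 (the amplified second moment for a FIXED squarefull `b`, coefficients squarefree and
coprime to `bk`) is thereby in the tree. [cite: BettinChandee2018, §§5–7]
[cite: DukeFriedlanderIwaniec1997, Theorem 2] -/
theorem DukeFriedlanderIwaniec1997_bilinearKloostermanFractions_of_Cb_bound
    (h52 : ∀ ε : ℝ, 0 < ε → ∃ K : ℝ, 0 < K ∧ ∀ (b : ℕ), 0 < b → (∀ p ∈ b.primeFactors, p ^ 2 ∣ b) →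
      ∀ (M N' : ℝ), 1 / 2 ≤ M → 1 / 2 ≤ N' → (b : ℝ) ≤ N' → ∀ (k : ℤ), k ≠ 0 → b.Coprime k.natAbs →
      ∀ (γ : ℕ → ℂ),
        (∀ n : ℕ, γ n ≠ 0 → N' < n ∧ (n : ℝ) ≤ 2 * N') →
        (∀ n : ℕ, γ n ≠ 0 → Squarefree n ∧ n.Coprime b ∧ n.Coprime k.natAbs) →
        ∑ m ∈ (Ioc ⌊M⌋₊ ⌊2 * M⌋₊).filter (fun m => m.Coprime b), ‖kfInner k b N' γ m‖ ^ 2 ≤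
          K * (∑ n ∈ Icc 1 ⌊2 * N'⌋₊, ‖γ n‖ ^ 2) *
          ((b : ℝ) * M * N' * (1 + |(k : ℝ)|)) ^ ε * (1 + |(k : ℝ)| / ((b : ℝ) * N' * M)) ^ (1 / 2 : ℝ) *
          (M * ((b : ℝ) * N') ^ (1 / 2 : ℝ) + (b : ℝ) ^ (3 / 4 : ℝ) * M ^ (1 / 2 : ℝ) * N' ^ (5 / 4 : ℝ) +
            M ^ (6 / 5 : ℝ) * N' ^ (1 / 10 : ℝ) * (b : ℝ) ^ (-(2 / 5) : ℝ) +
            (b : ℝ) ^ (1 / 5 : ℝ) * M ^ (6 / 5 : ℝ) * N' ^ (7 / 10 : ℝ) +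
            (b : ℝ) ^ (1 / 2 : ℝ) * M ^ (3 / 5 : ℝ) * N' ^ (13 / 10 : ℝ) + (b : ℝ) ^ (1 / 2 : ℝ) * N' ^ (7 / 4 : ℝ))) :
    DukeFriedlanderIwaniec1997_bilinearKloostermanFractions :=
  DukeFriedlanderIwaniec1997_bilinearKloostermanFractions_of_C1_bound (BC_C1_bound_of_Cb_bound h52)

end Literature.NumberTheory.LFunctions

end
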